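import Summits.ResolutionOfSingularities.ResolutionOfSingularities.Theorems.WildConesClassicalRegimesDefs
import Mathlib.Algebra.CharP.Defs
import HarnessLib

/-!
# [OURS · L1 W4.6, rung (ii)] STATEMENTS of the hyperbolic-splitting-regime package (instance p = 2 proved) over
# route WildCones' point-blow-up dynamics — campaign s46 of cell res-hironaka (LADDER-RESOLUTION rung L, D-0089);
# host route WildCones, `--kind definition --supports stmt-ResolutionOfSingularities-16884` (`ClassicalRegimes`)

HONEST FRAMING. Everything below is OURS (campaign statements of slot W4.6, typed by the prover res-L1-s46-pv-4 (gen 2)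
in the pattern of res-L1-type-o1's `Theorems/WildConesCampaignW46ThreefoldsCharTwoStatement.lean` (p468935): predicates
`def … (p : ℕ) : Prop` in the characteristic, one decl per statement, no theorem, no `sorry`) over route WildCones' typed
point-blow-up dynamics (`Theorems/WildConesClassicalRegimesDefs.lean`: `WildCones.step`, `run`, `clean`, `Isol`, `MultP`,
`OrdP`, `mu`). NOTHING here is a statement of H. Hironaka's manuscript [Hironaka2017] and nothing is asserted. Their
PROOFS at `p = 2` are res-L1-s46-pv-4's `Theorems/WildConesCampaignW46ThreefoldsCharTwo{SplittingRegime,Resolution,NearPoint}.lean`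
(p479260, p479500, p479531 ACCEPTED): `CampaignW46.ThreefoldsCharTwo.threefold_regime_step`, `threefold_isol_step_iff_ordP`,
`threefold_smooth_le_half`, `threefold_nearPoint_unique`, `threefold_mu_even`. This file only NAMES the statements so that
(a) the slot planner can register rank-9 items whose signature is a single constant and close them `--by` the prover's
theorems, and (b) the OURS lanes sign ONE decl per statement. THE REGIME: «order-2-cleaned double points» of the threefold
hypersurface `z^p = a(u₀,u₁,u₂)` — `MultP` (cleaned order `≥ p`) and `OrdP` (a cleaned monomial of degree exactly `p`; at
`p = 2` necessarily a square-free `u_j u_l`, a HYPERBOLIC PAIR of the quadratic form, the regime of the Greuel–Pfister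
splitting used by crux `ClassicalRegimes`' line `milnor-descent`). RELATION TO THE TYPED PROCEDURE (§16,
`Theorems/MarkedTransferCampaignW46TypedProcedure.lean`): as for p468935 — these statements live on the route's dynamics
of the height-one hypersurface under point blow-ups (the FORCED regime: isolated singularity, the point is the only
admissible centre; bridge `Theorems/MarkedTransferCampaignW46ForcedRegime.lean`, p468369), not on the §15 résumés.
For odd `p` the instances are NOT claimed by anyone (and `OrdP`/`μ/2` then mean something else); for non-prime `p ≠ 0`
the field quantifier is empty. They do NOT need `[PerfectField κ]`. AI review is weaker than expert review.

## Decls (namespace `…Theorems`)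

* `CampaignW46ThreefoldsSplittingClosed p` — CLOSURE of the regime under one step, with the exact drop `μ' + 2 = μ`.
* `CampaignW46ThreefoldsForcedDichotomy p` — for an isolated `p`-fold state with a `p`-fold successor: successor isolated
  IFF state order-`p` cleaned (the two strategies of `ClassicalRegimes` act on dynamically separated regimes).
* `CampaignW46ThreefoldsSplittingResolves p` — THE RUNG STATEMENT of this package: from an order-`p`-cleaned isolated
  state, along EVERY chart/translation word, a state with a LINEAR cleaned monomial (a smooth point of the transform)
  is reached at some stage `m ≤ μ(c₀)/2`, all earlier states being order-`p`-cleaned isolated `p`-fold points with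
  `μ(state k) + 2k = μ(c₀)`.
* `CampaignW46ThreefoldsNearPointUnique p` — DETERMINACY: two translations in one chart with `p`-fold successors agree
  off the chart index (at most one infinitely-near `p`-fold point per chart).
* `CampaignW46ThreefoldsMilnorEven p` — the Milnor number of an order-`p`-cleaned isolated `p`-fold state is even.
* (appended 2026-08-27) `CampaignW46ThreefoldsNearPointExists p` — a `p`-fold successor exists IFF `μ ≥ 4` (resolved by
  one blow-up iff `μ = 2`); `CampaignW46ThreefoldsSingularBranch p` — THE SINGULAR BRANCH: a word with exactly `μ/2`
  `p`-fold points followed by a smooth point (the bound `μ/2` is attained for every state of the regime). Proofs at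
  `p = 2`: `Theorems/WildConesCampaignW46ThreefoldsCharTwo{NearPointExists,SingularBranch}.lean` (p481532, SingularBranch).
* (appended 2026-08-27, rev 3) SCOPE MARKERS `CampaignW46ThreefoldsSidewaysExit p` (isolated, not order-`p`-cleaned state
  with an order-`p`-cleaned NON-isolated `p`-fold successor) and `CampaignW46FivefoldsSplittingNotClosed p` (in five
  variables the closure fails); proofs at `p = 2`: `…CharTwoFermatExit.lean` (p483423), `…HypersurfacesCharTwoFivefoldNonClosure.lean` (p484275).
* (appended 2026-08-27, rev 4) `CampaignW46FourfoldsSplittingNotClosed p` — the closure already fails in FOUR variables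
  (`…HypersurfacesCharTwoFourfoldNonClosure.lean`).

VACUITY (at `p = 2`). Not vacuous: `z² = u₀u₁ + u₂^(2j+1)` over `𝔽₂` is an order-2-cleaned isolated double point with
`μ = 2j` whose successor in chart `u₂` at `τ = 0` is again one for `j ≥ 2` (p470498: `forcedRun_pairPow`, `milnor_pairPow`);
the hypotheses `MultP ∧ OrdP ∧ Isol` are simultaneously satisfiable and the conclusions are not implied by bookkeeping.

## References

* res-L1-s46-pv-4 (gen 2), STATUS 2026-08-27 (ACCEPTED p478885 p479260 p479500 p479531); route file Theses/WildCones.lean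
  (`ClassicalRegimes`, stmt-16884); Theorems/WildConesCampaignW46ThreefoldsCharTwoStatement.lean (p468935, the pattern).
* H. Hironaka, ms. 2017-03-23 [Hironaka2017]: Th. 16.6 p.84 L3–L16 (centre `D ⊂ ∇(E)`, `D′ = ∇′ ∩ π⁻¹(D)`, Eq. (127));
  §16.3 p.87 L14–L24 («apply Th.(16.6) repeatedly … the repetition should sweep out the whole Sing»); Th. 16.13 p.87
  L25–L28 — quoted for the ROLE replaced only, under adjudication, not cited as fact.
* G.-M. Greuel, G. Pfister, The splitting lemma in any characteristic, J. Algebra 689 (2026) [GreuelPfister2026] —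
  context for the proofs (through the tree's `WildCones.MuDropCharTwoOrdP.pair_reduction`), not a premise here.
-/

noncomputable section

set_option linter.dupNamespace false -- mandated namespace of this single-conjunct summit

namespace Summit.ResolutionOfSingularities.ResolutionOfSingularities.Theorems

/-- [OURS · L1 W4.6 rung (ii)] replaces the role of Th. 16.6 (2) Eq. (127) p.84 L9–L16 TOGETHER WITH the renewal of the
procedure's hypotheses at the next stage (§16.3 p.87 L17–L18 «core-edge focusing is renewed … after each sequence of
blowups») for THREEFOLD HYPERSURFACE `p`-FOLD POINTS in the order-`p`-cleaned regime of route WildCones' point-blow-up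
dynamics; NOT a statement of the manuscript. For every field `κ` of characteristic `p`, every state `c` of
`z^p = a(u₀,u₁,u₂)` that is an order-`p`-cleaned isolated `p`-fold point (`MultP ∧ OrdP ∧ Isol`) and every chart `i`,
translation `τ` whose successor `step i τ c` is again a `p`-fold point (`MultP`): the successor is again order-`p` cleaned
AND isolated, and `μ(successor) + 2 = μ(c)`. The instance `p = 2` is PROVED by
`CampaignW46.ThreefoldsCharTwo.threefold_regime_step` (p479260); other `p` are not claimed. [folklore] -/
def CampaignW46ThreefoldsSplittingClosed (p : ℕ) : Prop :=
  ∀ (κ : Type) [Field κ] [CharP κ p] (c : (Fin 3 → ℕ) → κ) (i : Fin 3) (τ : Fin 3 → κ),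
    WildCones.MultP p 3 κ c → WildCones.OrdP p 3 κ c → WildCones.Isol p 3 κ c →
      WildCones.MultP p 3 κ (WildCones.step p 3 κ i τ c) →
        WildCones.OrdP p 3 κ (WildCones.step p 3 κ i τ c) ∧ WildCones.Isol p 3 κ (WildCones.step p 3 κ i τ c) ∧
          WildCones.mu p 3 κ (WildCones.step p 3 κ i τ c) + 2 = WildCones.mu p 3 κ c

/-- [OURS · L1 W4.6 rung (ii)] replaces the role of the centre-type bookkeeping of the iterated procedure (Th. 16.6 p.84
L4–L6: the next centre `D′ ⊂ ∇′`; §16.3 p.87 L14–L16) — «is the next singular point again ISOLATED?» — for threefold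
hypersurface `p`-fold points in route WildCones' dynamics, by a DICHOTOMY on the current state; NOT a statement of the
manuscript. For every field `κ` of characteristic `p`, every ISOLATED `p`-fold state `c` and every chart/translation whose
successor is a `p`-fold point: the successor is isolated IFF `c` is order-`p` cleaned. (So at `p = 2` the two strategies of
crux `ClassicalRegimes` — hyperbolic splitting for order-2-cleaned states, Case-A exit for cleaned order `≥ 3` — act on
dynamically separated regimes.) Instance `p = 2` PROVED by `CampaignW46.ThreefoldsCharTwo.threefold_isol_step_iff_ordP`
(p479260), `PerfectField`-free; other `p` not claimed. [folklore] -/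
def CampaignW46ThreefoldsForcedDichotomy (p : ℕ) : Prop :=
  ∀ (κ : Type) [Field κ] [CharP κ p] (c : (Fin 3 → ℕ) → κ) (i : Fin 3) (τ : Fin 3 → κ),
    WildCones.MultP p 3 κ c → WildCones.Isol p 3 κ c → WildCones.MultP p 3 κ (WildCones.step p 3 κ i τ c) →
      (WildCones.Isol p 3 κ (WildCones.step p 3 κ i τ c) ↔ WildCones.OrdP p 3 κ c)

/-- [OURS · L1 W4.6 rung (ii)] replaces the role of Th. 16.13 p.87 L25–L28 («by applying Th.(16.6) … repeatedly but
finitely many times … we obtain the resolution of singularities») and of §16.3 p.87 L18–L24 («the repetition should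
sweep out the whole Sing») for THREEFOLD HYPERSURFACE `p`-FOLD POINTS in the order-`p`-cleaned isolated regime of route
WildCones' point-blow-up dynamics, WITH A NUMBER; NOT a statement of the manuscript. For every field `κ` of characteristic
`p`, every order-`p`-cleaned isolated state `c₀` of `z^p = a(u₀,u₁,u₂)` (`OrdP ∧ Isol`), every chart word `i` and
translation word `t`: at some stage `m ≤ μ(c₀)/2` the cleaned state has a LINEAR monomial (the transform
`z^p + ℓ(u) + …` is SMOOTH at the visited point), and every earlier state `k < m` is an order-`p`-cleaned isolated
`p`-fold point with `μ(state k) + 2k = μ(c₀)`. Instance `p = 2` PROVED by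
`CampaignW46.ThreefoldsCharTwo.threefold_smooth_le_half` (p479500); other `p` not claimed. [folklore] -/
def CampaignW46ThreefoldsSplittingResolves (p : ℕ) : Prop :=
  ∀ (κ : Type) [Field κ] [CharP κ p] (c₀ : (Fin 3 → ℕ) → κ) (i : ℕ → Fin 3) (t : ℕ → Fin 3 → κ),
    WildCones.OrdP p 3 κ c₀ → WildCones.Isol p 3 κ c₀ →
      ∃ m ≤ WildCones.mu p 3 κ c₀ / 2,
        (∃ A, WildCones.clean p 3 κ (WildCones.run p 3 κ c₀ i t m) A ≠ 0 ∧
          Finset.sum Finset.univ (fun j => A j) = 1) ∧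
        ∀ k < m, WildCones.MultP p 3 κ (WildCones.run p 3 κ c₀ i t k) ∧
          WildCones.OrdP p 3 κ (WildCones.run p 3 κ c₀ i t k) ∧ WildCones.Isol p 3 κ (WildCones.run p 3 κ c₀ i t k) ∧
          WildCones.mu p 3 κ (WildCones.run p 3 κ c₀ i t k) + 2 * k = WildCones.mu p 3 κ c₀

/-- [OURS · L1 W4.6 rung (ii)] replaces the role of the DETERMINACY of the next centre (Th. 16.6 p.84 L5–L6:
`D′ = ∇′ ∩ π⁻¹(D)` is determined by the data) for threefold hypersurface `p`-fold points in the order-`p`-cleaned regime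
of route WildCones' dynamics; NOT a statement of the manuscript. For every field `κ` of characteristic `p`, every
order-`p`-cleaned `p`-fold state `c`, every chart `i` and translations `τ, τ'`: if both successors `step i τ c`,
`step i τ' c` are `p`-fold points then `τ` and `τ'` agree off the chart index — at most ONE infinitely-near `p`-fold point
per chart (at `p = 2`: the radical of the polar form of the quadratic part, `threefold_nearPoint_formula`). Instance
`p = 2` PROVED by `CampaignW46.ThreefoldsCharTwo.threefold_nearPoint_unique` (p479531); other `p` not claimed. [folklore] -/
def CampaignW46ThreefoldsNearPointUnique (p : ℕ) : Prop :=
  ∀ (κ : Type) [Field κ] [CharP κ p] (c : (Fin 3 → ℕ) → κ) (i : Fin 3) (τ τ' : Fin 3 → κ),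
    WildCones.MultP p 3 κ c → WildCones.OrdP p 3 κ c → WildCones.MultP p 3 κ (WildCones.step p 3 κ i τ c) →
      WildCones.MultP p 3 κ (WildCones.step p 3 κ i τ' c) → ∀ m ≠ i, τ m = τ' m

/-- [OURS · L1 W4.6 rung (ii)] replaces the role of the VALUE SET of the procedure's invariant (the `Inv`-strings of
Eq. (127) p.84 L10–L12) by OUR invariant in this regime; NOT a statement of the manuscript. For every field `κ` of
characteristic `p` and every order-`p`-cleaned isolated `p`-fold state `c` of `z^p = a(u₀,u₁,u₂)`, the Milnor number
`μ(c) = dim_κ κ⟦u⟧/(∂a)` is EVEN (at `p = 2` the Milnor algebra is `κ⟦X⟧/(X^μ)`, `threefold_milnorAlgebra_equiv`, and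
every even value `≥ 2` occurs, p470498). Instance `p = 2` PROVED by `CampaignW46.ThreefoldsCharTwo.threefold_mu_even`
(p479260); other `p` not claimed. [folklore] -/
def CampaignW46ThreefoldsMilnorEven (p : ℕ) : Prop :=
  ∀ (κ : Type) [Field κ] [CharP κ p] (c : (Fin 3 → ℕ) → κ),
    WildCones.MultP p 3 κ c → WildCones.OrdP p 3 κ c → WildCones.Isol p 3 κ c → Even (WildCones.mu p 3 κ c)

/-- [OURS · L1 W4.6 rung (ii)] replaces the role of the EXISTENCE of a next centre while the singular locus
is not yet empty (Th. 16.6 p.84 L4–L6: a centre `D ⊂ ∇(E)`; §16.3 p.87 L19–L24 «the repetition should sweep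
out the whole Sing») for threefold hypersurface `p`-fold points in the order-`p`-cleaned isolated regime of
route WildCones' point-blow-up dynamics, by a CRITERION in OUR invariant; NOT a statement of the manuscript.
For every field `κ` of characteristic `p` and every order-`p`-cleaned isolated `p`-fold state `c` of
`z^p = a(u₀,u₁,u₂)`: some point-blow-up successor of `c` (some chart `i`, translation `τ`) is again a `p`-fold
point IFF `μ(c) ≥ 4` — equivalently, `c` is resolved by ONE blow-up (every successor a smooth point) iff
`μ(c) = 2`. Instance `p = 2` PROVED by `CampaignW46.ThreefoldsCharTwo.threefold_exists_double_successor_iff_four_le_mu`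
(p481532: the successor at the PINNED translation — the radical of the polar form — in the chart off a
hyperbolic pair); other `p` not claimed. Appended 2026-08-27 by res-L1-s46-pv-4 (gen 2). [folklore] -/
def CampaignW46ThreefoldsNearPointExists (p : ℕ) : Prop :=
  ∀ (κ : Type) [Field κ] [CharP κ p] (c : (Fin 3 → ℕ) → κ),
    WildCones.MultP p 3 κ c → WildCones.OrdP p 3 κ c → WildCones.Isol p 3 κ c →
      ((∃ (i : Fin 3) (τ : Fin 3 → κ), WildCones.MultP p 3 κ (WildCones.step p 3 κ i τ c)) ↔
        4 ≤ WildCones.mu p 3 κ c)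

/-- [OURS · L1 W4.6 rung (ii)] replaces the role of the LENGTH of the procedure of Th. 16.13 p.87 L25–L28
(«by applying Th.(16.6) … repeatedly but finitely many times») for threefold hypersurface `p`-fold points in
the order-`p`-cleaned isolated regime of route WildCones' point-blow-up dynamics, by an EXACT COUNT in OUR
invariant; NOT a statement of the manuscript. For every field `κ` of characteristic `p` and every
order-`p`-cleaned isolated `p`-fold state `c₀` of `z^p = a(u₀,u₁,u₂)` there are a chart word `i` and a
translation word `t` (THE SINGULAR BRANCH) along which every state `m` with `2m + 2 ≤ μ(c₀)` is an
order-`p`-cleaned isolated `p`-fold point with `μ(state m) + 2m = μ(c₀)`, while the state `μ(c₀)/2` is NOT a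
`p`-fold point and carries a LINEAR cleaned monomial (smooth): exactly `μ(c₀)/2` blow-ups resolve the branch,
and (with `CampaignW46ThreefoldsSplittingResolves`) `μ(c₀)/2` is the exact depth of the point-blow-up
resolution tree. Instance `p = 2` PROVED by `CampaignW46.ThreefoldsCharTwo.threefold_singularBranch_exact`
(Theorems/WildConesCampaignW46ThreefoldsCharTwoSingularBranch.lean); other `p` not claimed. Appended 2026-08-27
by res-L1-s46-pv-4 (gen 2). [folklore] -/
def CampaignW46ThreefoldsSingularBranch (p : ℕ) : Prop :=
  ∀ (κ : Type) [Field κ] [CharP κ p] (c₀ : (Fin 3 → ℕ) → κ),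
    WildCones.MultP p 3 κ c₀ → WildCones.OrdP p 3 κ c₀ → WildCones.Isol p 3 κ c₀ →
      ∃ (i : ℕ → Fin 3) (t : ℕ → Fin 3 → κ),
        (∀ m, 2 * m + 2 ≤ WildCones.mu p 3 κ c₀ →
          WildCones.MultP p 3 κ (WildCones.run p 3 κ c₀ i t m) ∧ WildCones.OrdP p 3 κ (WildCones.run p 3 κ c₀ i t m) ∧
            WildCones.Isol p 3 κ (WildCones.run p 3 κ c₀ i t m) ∧
            WildCones.mu p 3 κ (WildCones.run p 3 κ c₀ i t m) + 2 * m = WildCones.mu p 3 κ c₀) ∧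
        ¬ WildCones.MultP p 3 κ (WildCones.run p 3 κ c₀ i t (WildCones.mu p 3 κ c₀ / 2)) ∧
        ∃ A, WildCones.clean p 3 κ (WildCones.run p 3 κ c₀ i t (WildCones.mu p 3 κ c₀ / 2)) A ≠ 0 ∧
          Finset.sum Finset.univ (fun j => A j) = 1

/-- [OURS · L1 W4.6 rung (ii), SCOPE MARKER] replaces the role of NO printed item: it delimits the forced
(point-blow-up) regime of rung (ii) inside route WildCones' dynamics; NOT a statement of the manuscript. For every
field `κ` of characteristic `p` there are a state `c` of the threefold `z^p = a(u₀,u₁,u₂)` that is an ISOLATED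
`p`-fold point NOT order-`p` cleaned, and a chart/translation whose successor is an order-`p`-cleaned `p`-fold
point that is NOT isolated — the procedure leaves the forced regime SIDEWAYS (next centre one-dimensional,
outside the route's point dynamics). Instance `p = 2` PROVED by `CampaignW46.ThreefoldsCharTwo.threefold_exists_sidewaysExit`
(p483423: the Fermat cubic `u₀³ + u₁³ + u₂³`, `μ = 8`, chart `u₀`, point `(1, 0)` of the cubic); other `p` not
claimed. Appended 2026-08-27 by res-L1-s46-pv-4 (gen 2). [folklore] -/
def CampaignW46ThreefoldsSidewaysExit (p : ℕ) : Prop :=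
  ∀ (κ : Type) [Field κ] [CharP κ p], ∃ (c : (Fin 3 → ℕ) → κ) (i : Fin 3) (τ : Fin 3 → κ),
    WildCones.Isol p 3 κ c ∧ WildCones.MultP p 3 κ c ∧ ¬ WildCones.OrdP p 3 κ c ∧
      WildCones.MultP p 3 κ (WildCones.step p 3 κ i τ c) ∧ WildCones.OrdP p 3 κ (WildCones.step p 3 κ i τ c) ∧
        ¬ WildCones.Isol p 3 κ (WildCones.step p 3 κ i τ c)

/-- [OURS · L1 W4.6 rung (ii), SCOPE MARKER] replaces the role of NO printed item: it records that the CLOSURE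
statement `CampaignW46ThreefoldsSplittingClosed` is a THREEFOLD phenomenon; NOT a statement of the manuscript.
For every field `κ` of characteristic `p` there are an order-`p`-cleaned ISOLATED `p`-fold state `c` of the
FIVEFOLD hypersurface `z^p = a(u₀,…,u₄)` and a chart/translation whose successor is an order-`p`-cleaned
`p`-fold point that is NOT isolated. Instance `p = 2` PROVED by
`CampaignW46.ThreefoldsCharTwo.fivefold_splittingRegime_not_closed` (p484275: `a = u₀u₁ + u₂³ + u₃³ + u₄³`,
chart `u₂`, `u₃ ↦ u₃ + 1`; `(∂G) ⊆ (u₀, u₁, u₂, u₃ + u₃² + u₃³ + u₄³)`, Krull); other `p` not claimed.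
Appended 2026-08-27 by res-L1-s46-pv-4 (gen 2). [folklore] -/
def CampaignW46FivefoldsSplittingNotClosed (p : ℕ) : Prop :=
  ∀ (κ : Type) [Field κ] [CharP κ p], ∃ (c : (Fin 5 → ℕ) → κ) (i : Fin 5) (τ : Fin 5 → κ),
    WildCones.Isol p 5 κ c ∧ WildCones.MultP p 5 κ c ∧ WildCones.OrdP p 5 κ c ∧
      WildCones.MultP p 5 κ (WildCones.step p 5 κ i τ c) ∧ WildCones.OrdP p 5 κ (WildCones.step p 5 κ i τ c) ∧
        ¬ WildCones.Isol p 5 κ (WildCones.step p 5 κ i τ c)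

/-- [OURS · L1 W4.6 rung (ii), SCOPE MARKER] replaces the role of NO printed item: the closure statement
`CampaignW46ThreefoldsSplittingClosed` already fails in FOUR variables; NOT a statement of the manuscript. For every
field `κ` of characteristic `p` there are an order-`p`-cleaned ISOLATED `p`-fold state `c` of the FOURFOLD hypersurface
`z^p = a(u₀,u₁,u₂,u₃)` and a chart/translation whose successor is an order-`p`-cleaned `p`-fold point that is NOT
isolated. Instance `p = 2` PROVED by `CampaignW46.ThreefoldsCharTwo.fourfold_splittingRegime_not_closed`
(`a = u₀u₁ + u₂⁵ + u₃⁵`, chart `u₂`, no translation; `(∂G) ⊆ (u₀, u₁, u₂)`, Krull); other `p` not claimed.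
Appended 2026-08-27 by res-L1-s46-pv-4 (gen 2), rev 4. [folklore] -/
def CampaignW46FourfoldsSplittingNotClosed (p : ℕ) : Prop :=
  ∀ (κ : Type) [Field κ] [CharP κ p], ∃ (c : (Fin 4 → ℕ) → κ) (i : Fin 4) (τ : Fin 4 → κ),
    WildCones.Isol p 4 κ c ∧ WildCones.MultP p 4 κ c ∧ WildCones.OrdP p 4 κ c ∧
      WildCones.MultP p 4 κ (WildCones.step p 4 κ i τ c) ∧ WildCones.OrdP p 4 κ (WildCones.step p 4 κ i τ c) ∧
        ¬ WildCones.Isol p 4 κ (WildCones.step p 4 κ i τ c)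

end Summit.ResolutionOfSingularities.ResolutionOfSingularities.Theorems

end
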